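import Summits.NavierStokesRegularity.NavierStokesRegularity.Theorems.PalasekTowerBreakdownEpisodeBaseTAgmonExplicitSobolev
import Literature.Analysis.FluidPDE.NSRobustnessOfRegularityAgmonBound

/-!
# The explicit Agmon contract on `ℝ³`: `AgmonBoundR3 (√2/π)`, and `√2/π < 0.4502`

Cell `ns-blowup`, seat `ns-palasek-20303-p1` (g0, LEAD prover of the crux `EpisodeBaseT` = item
stmt-NavierStokesRegularity-20303, line `straindoor`; `--supports` that item, helper lane). LABEL: E–C analysis (KERNEL:
theorems only; no definition, no named fact, no `sorry`; register-free).

The Literature contract `AgmonBoundR3 A` (`NSRobustnessOfRegularityAgmonBound`: `0 ≤ A` and Agmon's inequality on `ℝ³`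
with constant `A` in the robustness vein's quantities `(∫|∇w|²_F · ∫‖Δw‖²)^{1/4}`, for `C^∞` fields with all
derivatives in `L²`) is met by the EXPLICIT constant `√2/π` of the Fourier proof (19179-p2 g6
`AgmonExplicit.norm_le_agmon_explicit_complex` → this seat's weak-hypothesis currency twin
`AgmonExplicitSobolev.norm_le_explicitAgmon_mul_rpow`, p538670). Once the vein
(`classicalNS_norm_sub_le_strain_window_half_R3` and parents) is re-threaded over `(hA : AgmonBoundR3 A)` (memo
DESIGN-PRICE-MEMO-20303 §8, ask by name to the `ns-blowup-lit` lineage), instantiating at `agmonBoundR3_explicit` turns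
the three `agmonConst` fields of the `H²`-currency certificate letter `StrainDoor.CertificateDataH2` (p536855) into
numerals; `sqrt_two_div_pi_lt` is the decimal a certificate compares against.

WHAT THIS IS NOT: not Navier–Stokes evidence — a Sobolev constant; no flow, design, run or certificate exhibited.
References: J. C. Robinson, J. L. Rodrigo, W. Sadowski, CUP 2016, Thm. 1.20 [cite: RobinsonRodrigoSadowski2016, Thm. 1.20];
E. M. Stein, G. Weiss, Princeton 1971, Ch. I Thm. 2.3 [cite: SteinWeiss1971, Ch. I Thm. 2.3].
-/

noncomputable section

set_option linter.dupNamespace false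

open MeasureTheory Literature.Analysis Literature.Analysis.FluidPDE
open scoped ENNReal ContDiff Laplacian

namespace Summit.NavierStokesRegularity.NavierStokesRegularity.Theorems.AgmonExplicitSobolev

/-- **The explicit Agmon contract**: `AgmonBoundR3 (√2/π)`. [cite: SteinWeiss1971, Ch. I Thm. 2.3]
[cite: RobinsonRodrigoSadowski2016, Thm. 1.20] -/
theorem agmonBoundR3_explicit : AgmonBoundR3 (Real.sqrt 2 / Real.pi) :=
  ⟨by positivity, fun _ hw hn x => norm_le_explicitAgmon_mul_rpow hw hn x⟩

/-- The decimal: `√2/π < 0.4502`. [cite: RobinsonRodrigoSadowski2016, Thm. 1.20] -/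
theorem sqrt_two_div_pi_lt : Real.sqrt 2 / Real.pi < 4502 / 10000 := by
  have hπ := Real.pi_gt_d6
  have h2 : Real.sqrt 2 < 141422 / 100000 := by
    rw [Real.sqrt_lt' (by norm_num)]; norm_num
  rw [div_lt_iff₀ Real.pi_pos]
  nlinarith [Real.sqrt_nonneg 2]

/-- Every Agmon contract with a constant `≥ √2/π` holds; in particular any decimal `A ≥ 0.4502` may be used in a
certificate. [cite: RobinsonRodrigoSadowski2016, Thm. 1.20] -/
theorem agmonBoundR3_of_ge {A : ℝ} (hA : Real.sqrt 2 / Real.pi ≤ A) : AgmonBoundR3 A :=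
  agmonBoundR3_explicit.mono hA

end Summit.NavierStokesRegularity.NavierStokesRegularity.Theorems.AgmonExplicitSobolev

end
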